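import Mathlib

/-!
# `TateLifting` (stmt-KontsevichZagierPeriods-9129), line `Sketch` — stub 53 `IsotropySpace`,
# auxiliary file 2: partial derivatives of the stereographic frame functions

For the space engine (`Theorems/InverseLandauTateLiftingIsotropySpace.lean`) the chart
`Ψ(a, b, ρ, y₃, y₄) = (ρ ω(a,b), M(a,b) y₃, M(a,b) y₄)` of `(ℝ³)³ = ℝ⁹` is built from the six rational
functions of `(a, b) = (w 0, w 1)`
`p = 2a/D`, `q = 2b/D`, `t = (1 − a² − b²)/D`, `e = (a² − b² − 1)/D`, `f = (b² − a² − 1)/D`,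
`g = 2ab/D`, `D = 1 + a² + b²`. This file records their partial derivatives as Fréchet derivatives
on `ℝ⁹` (read on the first two coordinates; `hasFDerivAt_p`, …, `hasFDerivAt_g`, all from one
quotient-rule lemma `hasFDerivAt_ratFun`), and the `3 × 3` determinant of the stereographic block
`(ρ ∂_a ω, ρ ∂_b ω, ω)` of the Jacobian: `4ρ²/D²` (`det_stereoBlock`) — the area element
`4/(1 + a² + b²)²` of the inverse stereographic projection times `ρ²`. The functions and their
partials are kept abstract as `ℝ → ℝ → ℝ` functions constrained by defining equations (no
definitions are introduced; pure proof file). References: folklore calculus.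
-/

noncomputable section

namespace Summit.KontsevichZagierPeriods.InverseLandau

namespace IsotropySpace

/-! ### One quotient rule for all six functions -/

/-- The denominator `D(w) = 1 + w₀² + w₁²` is differentiable with derivative
`v ↦ 2w₀v₀ + 2w₁v₁`. [folklore] -/
theorem hasFDerivAt_denom (x : Fin 9 → ℝ) :
    HasFDerivAt (fun w : Fin 9 → ℝ => 1 + w 0 ^ 2 + w 1 ^ 2)
      ((2 * x 0) • ContinuousLinearMap.proj (R := ℝ) (φ := fun _ : Fin 9 => ℝ) 0 +
        (2 * x 1) • ContinuousLinearMap.proj (R := ℝ) (φ := fun _ : Fin 9 => ℝ) 1) x := by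
  have hP : ∀ i : Fin 9, HasFDerivAt (fun w : Fin 9 → ℝ => w i)
      (ContinuousLinearMap.proj (R := ℝ) (φ := fun _ : Fin 9 => ℝ) i) x :=
    fun i => hasFDerivAt_apply i x
  have h := ((hP 0).pow 2).add ((hP 1).pow 2)
  have h1 := h.const_add 1
  refine h1.congr_fderiv (ContinuousLinearMap.ext fun v => ?_) |>.congr_of_eventuallyEq
    (Filter.Eventually.of_forall fun w => by simp only [Pi.add_apply]; ring)
  simp only [_root_.add_apply, _root_.smul_apply,
    ContinuousLinearMap.proj_apply, smul_eq_mul, Nat.cast_ofNat, nsmul_eq_mul]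
  ring

/-- **Quotient rule on `ℝ⁹` with the denominator `D = 1 + w₀² + w₁²`.** If `N` has derivative `N′`
at `x`, then `N/D` has derivative `L` at `x` as soon as
`L v = (D(x) N′v − N(x)(2x₀v₀ + 2x₁v₁))/D(x)²` for all `v`. [folklore] -/
theorem hasFDerivAt_ratFun {N : (Fin 9 → ℝ) → ℝ} {N' : (Fin 9 → ℝ) →L[ℝ] ℝ} {x : Fin 9 → ℝ}
    (hN : HasFDerivAt N N' x) (L : (Fin 9 → ℝ) →L[ℝ] ℝ)
    (hL : ∀ v, L v = ((1 + x 0 ^ 2 + x 1 ^ 2) * N' v - N x * (2 * x 0 * v 0 + 2 * x 1 * v 1)) /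
      (1 + x 0 ^ 2 + x 1 ^ 2) ^ 2) :
    HasFDerivAt (fun w => N w / (1 + w 0 ^ 2 + w 1 ^ 2)) L x := by
  have hD : (1 : ℝ) + x 0 ^ 2 + x 1 ^ 2 ≠ 0 := by positivity
  have hinv := (hasFDerivAt_inv hD).comp x (hasFDerivAt_denom x)
  have hmul := hN.mul hinv
  have key : HasFDerivAt (N * ((fun y : ℝ => y⁻¹) ∘ fun w : Fin 9 → ℝ => 1 + w 0 ^ 2 + w 1 ^ 2)) L x := by
    refine hmul.congr_fderiv (ContinuousLinearMap.ext fun v => ?_)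
    rw [hL v]
    simp only [_root_.add_apply, _root_.smul_apply, ContinuousLinearMap.coe_comp,
      Function.comp_apply, ContinuousLinearMap.proj_apply,
      ContinuousLinearMap.toSpanSingleton_apply, smul_eq_mul]
    field_simp
    ring
  have hfun : (fun w : Fin 9 → ℝ => N w / (1 + w 0 ^ 2 + w 1 ^ 2)) =
      N * ((fun y : ℝ => y⁻¹) ∘ fun w : Fin 9 → ℝ => 1 + w 0 ^ 2 + w 1 ^ 2) := by
    funext w
    simp only [Pi.mul_apply, Function.comp_apply, div_eq_mul_inv]
  rw [hfun]
  exact key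

/-! ### The six functions and their partials -/

section Partials

variable {p q t e f g : ℝ → ℝ → ℝ}
  (hp : ∀ a b, p a b = 2 * a / (1 + a ^ 2 + b ^ 2))
  (hq : ∀ a b, q a b = 2 * b / (1 + a ^ 2 + b ^ 2))
  (ht : ∀ a b, t a b = (1 - a ^ 2 - b ^ 2) / (1 + a ^ 2 + b ^ 2))
  (he : ∀ a b, e a b = (a ^ 2 - b ^ 2 - 1) / (1 + a ^ 2 + b ^ 2))
  (hf : ∀ a b, f a b = (b ^ 2 - a ^ 2 - 1) / (1 + a ^ 2 + b ^ 2))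
  (hg : ∀ a b, g a b = 2 * a * b / (1 + a ^ 2 + b ^ 2))
variable {pa pb qa qb ta tb ea eb fa fb ga gb : ℝ → ℝ → ℝ}
  (hpa : ∀ a b, pa a b = (2 + 2 * b ^ 2 - 2 * a ^ 2) / (1 + a ^ 2 + b ^ 2) ^ 2)
  (hpb : ∀ a b, pb a b = -(4 * a * b) / (1 + a ^ 2 + b ^ 2) ^ 2)
  (hqa : ∀ a b, qa a b = -(4 * a * b) / (1 + a ^ 2 + b ^ 2) ^ 2)
  (hqb : ∀ a b, qb a b = (2 + 2 * a ^ 2 - 2 * b ^ 2) / (1 + a ^ 2 + b ^ 2) ^ 2)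
  (hta : ∀ a b, ta a b = -(4 * a) / (1 + a ^ 2 + b ^ 2) ^ 2)
  (htb : ∀ a b, tb a b = -(4 * b) / (1 + a ^ 2 + b ^ 2) ^ 2)
  (hea : ∀ a b, ea a b = 4 * a * (1 + b ^ 2) / (1 + a ^ 2 + b ^ 2) ^ 2)
  (heb : ∀ a b, eb a b = -(4 * a ^ 2 * b) / (1 + a ^ 2 + b ^ 2) ^ 2)
  (hfa : ∀ a b, fa a b = -(4 * a * b ^ 2) / (1 + a ^ 2 + b ^ 2) ^ 2)
  (hfb : ∀ a b, fb a b = 4 * b * (1 + a ^ 2) / (1 + a ^ 2 + b ^ 2) ^ 2)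
  (hga : ∀ a b, ga a b = 2 * b * (1 + b ^ 2 - a ^ 2) / (1 + a ^ 2 + b ^ 2) ^ 2)
  (hgb : ∀ a b, gb a b = 2 * a * (1 + a ^ 2 - b ^ 2) / (1 + a ^ 2 + b ^ 2) ^ 2)

include hp hpa hpb in
/-- `∂p = p_a da + p_b db`. [folklore] -/
theorem hasFDerivAt_p (x : Fin 9 → ℝ) :
    HasFDerivAt (fun w : Fin 9 → ℝ => p (w 0) (w 1)) (pa (x 0) (x 1) • (ContinuousLinearMap.proj 0 : (Fin 9 → ℝ) →L[ℝ] ℝ) + pb (x 0) (x 1) • (ContinuousLinearMap.proj 1 : (Fin 9 → ℝ) →L[ℝ] ℝ)) x := by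
  have hN : HasFDerivAt (fun w : Fin 9 → ℝ => 2 * w 0) ((2 : ℝ) • (ContinuousLinearMap.proj 0 : (Fin 9 → ℝ) →L[ℝ] ℝ)) x :=
    (hasFDerivAt_apply 0 x).const_smul (2 : ℝ)
  rw [show (fun w : Fin 9 → ℝ => p (w 0) (w 1)) = fun w => (2 * w 0) / (1 + w 0 ^ 2 + w 1 ^ 2)
    from funext fun w => hp _ _]
  refine hasFDerivAt_ratFun hN _ fun v => ?_
  have hD : (1 : ℝ) + x 0 ^ 2 + x 1 ^ 2 ≠ 0 := by positivity
  simp only [_root_.add_apply, _root_.smul_apply,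
    ContinuousLinearMap.proj_apply, smul_eq_mul, hpa, hpb]
  field_simp
  ring

include hq hqa hqb in
/-- `∂q = q_a da + q_b db`. [folklore] -/
theorem hasFDerivAt_q (x : Fin 9 → ℝ) :
    HasFDerivAt (fun w : Fin 9 → ℝ => q (w 0) (w 1)) (qa (x 0) (x 1) • (ContinuousLinearMap.proj 0 : (Fin 9 → ℝ) →L[ℝ] ℝ) + qb (x 0) (x 1) • (ContinuousLinearMap.proj 1 : (Fin 9 → ℝ) →L[ℝ] ℝ)) x := by
  have hN : HasFDerivAt (fun w : Fin 9 → ℝ => 2 * w 1) ((2 : ℝ) • (ContinuousLinearMap.proj 1 : (Fin 9 → ℝ) →L[ℝ] ℝ)) x :=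
    (hasFDerivAt_apply 1 x).const_smul (2 : ℝ)
  rw [show (fun w : Fin 9 → ℝ => q (w 0) (w 1)) = fun w => (2 * w 1) / (1 + w 0 ^ 2 + w 1 ^ 2)
    from funext fun w => hq _ _]
  refine hasFDerivAt_ratFun hN _ fun v => ?_
  have hD : (1 : ℝ) + x 0 ^ 2 + x 1 ^ 2 ≠ 0 := by positivity
  simp only [_root_.add_apply, _root_.smul_apply,
    ContinuousLinearMap.proj_apply, smul_eq_mul, hqa, hqb]
  field_simp
  ring

/-- The numerators `α + β w₀² + γ w₁²` are differentiable. [folklore] -/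
theorem hasFDerivAt_quadNum (α β γ : ℝ) (x : Fin 9 → ℝ) :
    HasFDerivAt (fun w : Fin 9 → ℝ => α + β * w 0 ^ 2 + γ * w 1 ^ 2)
      ((2 * β * x 0) • (ContinuousLinearMap.proj 0 : (Fin 9 → ℝ) →L[ℝ] ℝ) + (2 * γ * x 1) • (ContinuousLinearMap.proj 1 : (Fin 9 → ℝ) →L[ℝ] ℝ)) x := by
  have hP : ∀ i : Fin 9, HasFDerivAt (fun w : Fin 9 → ℝ => w i) (ContinuousLinearMap.proj i : (Fin 9 → ℝ) →L[ℝ] ℝ) x :=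
    fun i => hasFDerivAt_apply i x
  have h := ((((hP 0).pow 2).const_mul β).add (((hP 1).pow 2).const_mul γ)).const_add α
  refine (h.congr_fderiv (ContinuousLinearMap.ext fun v => ?_)).congr_of_eventuallyEq
    (Filter.Eventually.of_forall fun w => by simp only [Pi.add_apply]; ring)
  simp only [_root_.add_apply, _root_.smul_apply,
    ContinuousLinearMap.proj_apply, smul_eq_mul, Nat.cast_ofNat, nsmul_eq_mul]
  ring

include ht hta htb in
/-- `∂t = t_a da + t_b db`. [folklore] -/
theorem hasFDerivAt_t (x : Fin 9 → ℝ) :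
    HasFDerivAt (fun w : Fin 9 → ℝ => t (w 0) (w 1)) (ta (x 0) (x 1) • (ContinuousLinearMap.proj 0 : (Fin 9 → ℝ) →L[ℝ] ℝ) + tb (x 0) (x 1) • (ContinuousLinearMap.proj 1 : (Fin 9 → ℝ) →L[ℝ] ℝ)) x := by
  rw [show (fun w : Fin 9 → ℝ => t (w 0) (w 1)) =
    fun w => (1 + (-1) * w 0 ^ 2 + (-1) * w 1 ^ 2) / (1 + w 0 ^ 2 + w 1 ^ 2)
    from funext fun w => by rw [ht]; ring]
  refine hasFDerivAt_ratFun (hasFDerivAt_quadNum 1 (-1) (-1) x) _ fun v => ?_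
  have hD : (1 : ℝ) + x 0 ^ 2 + x 1 ^ 2 ≠ 0 := by positivity
  simp only [_root_.add_apply, _root_.smul_apply,
    ContinuousLinearMap.proj_apply, smul_eq_mul, hta, htb]
  field_simp
  ring

include he hea heb in
/-- `∂e = e_a da + e_b db`. [folklore] -/
theorem hasFDerivAt_e (x : Fin 9 → ℝ) :
    HasFDerivAt (fun w : Fin 9 → ℝ => e (w 0) (w 1)) (ea (x 0) (x 1) • (ContinuousLinearMap.proj 0 : (Fin 9 → ℝ) →L[ℝ] ℝ) + eb (x 0) (x 1) • (ContinuousLinearMap.proj 1 : (Fin 9 → ℝ) →L[ℝ] ℝ)) x := by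
  rw [show (fun w : Fin 9 → ℝ => e (w 0) (w 1)) =
    fun w => ((-1) + 1 * w 0 ^ 2 + (-1) * w 1 ^ 2) / (1 + w 0 ^ 2 + w 1 ^ 2)
    from funext fun w => by rw [he]; ring]
  refine hasFDerivAt_ratFun (hasFDerivAt_quadNum (-1) 1 (-1) x) _ fun v => ?_
  have hD : (1 : ℝ) + x 0 ^ 2 + x 1 ^ 2 ≠ 0 := by positivity
  simp only [_root_.add_apply, _root_.smul_apply,
    ContinuousLinearMap.proj_apply, smul_eq_mul, hea, heb]
  field_simp
  ring

include hf hfa hfb in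
/-- `∂f = f_a da + f_b db`. [folklore] -/
theorem hasFDerivAt_f (x : Fin 9 → ℝ) :
    HasFDerivAt (fun w : Fin 9 → ℝ => f (w 0) (w 1)) (fa (x 0) (x 1) • (ContinuousLinearMap.proj 0 : (Fin 9 → ℝ) →L[ℝ] ℝ) + fb (x 0) (x 1) • (ContinuousLinearMap.proj 1 : (Fin 9 → ℝ) →L[ℝ] ℝ)) x := by
  rw [show (fun w : Fin 9 → ℝ => f (w 0) (w 1)) =
    fun w => ((-1) + (-1) * w 0 ^ 2 + 1 * w 1 ^ 2) / (1 + w 0 ^ 2 + w 1 ^ 2)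
    from funext fun w => by rw [hf]; ring]
  refine hasFDerivAt_ratFun (hasFDerivAt_quadNum (-1) (-1) 1 x) _ fun v => ?_
  have hD : (1 : ℝ) + x 0 ^ 2 + x 1 ^ 2 ≠ 0 := by positivity
  simp only [_root_.add_apply, _root_.smul_apply,
    ContinuousLinearMap.proj_apply, smul_eq_mul, hfa, hfb]
  field_simp
  ring

include hg hga hgb in
/-- `∂g = g_a da + g_b db`. [folklore] -/
theorem hasFDerivAt_g (x : Fin 9 → ℝ) :
    HasFDerivAt (fun w : Fin 9 → ℝ => g (w 0) (w 1)) (ga (x 0) (x 1) • (ContinuousLinearMap.proj 0 : (Fin 9 → ℝ) →L[ℝ] ℝ) + gb (x 0) (x 1) • (ContinuousLinearMap.proj 1 : (Fin 9 → ℝ) →L[ℝ] ℝ)) x := by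
  have hP : ∀ i : Fin 9, HasFDerivAt (fun w : Fin 9 → ℝ => w i) (ContinuousLinearMap.proj i : (Fin 9 → ℝ) →L[ℝ] ℝ) x :=
    fun i => hasFDerivAt_apply i x
  have hN : HasFDerivAt (fun w : Fin 9 → ℝ => 2 * w 0 * w 1)
      ((2 * x 0) • (ContinuousLinearMap.proj 1 : (Fin 9 → ℝ) →L[ℝ] ℝ) + (2 * x 1) • (ContinuousLinearMap.proj 0 : (Fin 9 → ℝ) →L[ℝ] ℝ)) x := by
    refine (((hP 0).const_mul 2).mul (hP 1)).congr_fderiv (ContinuousLinearMap.ext fun v => ?_)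
    simp only [_root_.add_apply, _root_.smul_apply,
      ContinuousLinearMap.proj_apply, smul_eq_mul]
    ring
  rw [show (fun w : Fin 9 → ℝ => g (w 0) (w 1)) = fun w => (2 * w 0 * w 1) / (1 + w 0 ^ 2 + w 1 ^ 2)
    from funext fun w => hg _ _]
  refine hasFDerivAt_ratFun hN _ fun v => ?_
  have hD : (1 : ℝ) + x 0 ^ 2 + x 1 ^ 2 ≠ 0 := by positivity
  simp only [_root_.add_apply, _root_.smul_apply,
    ContinuousLinearMap.proj_apply, smul_eq_mul, hga, hgb]
  field_simp
  ring

include hp hq ht hpa hpb hqa hqb hta htb in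
/-- The determinant of the stereographic block `(ρ ∂_a ω, ρ ∂_b ω, ω)` of the Jacobian:
`4ρ²/(1 + a² + b²)²`. [folklore] -/
theorem det_stereoBlock (a b ρ : ℝ) :
    (!![ρ * pa a b, ρ * pb a b, p a b; ρ * qa a b, ρ * qb a b, q a b; ρ * ta a b, ρ * tb a b, t a b] :
      Matrix (Fin 3) (Fin 3) ℝ).det = 4 * ρ ^ 2 / (1 + a ^ 2 + b ^ 2) ^ 2 := by
  have h : (1 : ℝ) + a ^ 2 + b ^ 2 ≠ 0 := by positivity
  rw [Matrix.det_fin_three]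
  simp only [Matrix.of_apply, Matrix.cons_val', Matrix.cons_val_zero, Matrix.cons_val_one,
    Matrix.cons_val_two, Matrix.empty_val', Matrix.cons_val_fin_one, Matrix.head_cons,
    Matrix.head_fin_const, Matrix.tail_cons, hp, hq, ht, hpa, hpb, hqa, hqb, hta, htb]
  field_simp
  ring

end Partials

end IsotropySpace

/-- **Registered auxiliary sub-goal of stub 53 `IsotropySpace` (the stereographic area element).**
The `3 × 3` block `(ρ ∂_a ω, ρ ∂_b ω, ω)` of the Jacobian of the space-engine chart has determinant
`4ρ²/(1 + a² + b²)²` (`IsotropySpace.det_stereoBlock` with the explicit partials). [folklore] -/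
theorem tateLifting_isotropySpaceStereoDet :
    ∀ (a b ρ : ℝ),
      (!![ρ * ((2 + 2 * b ^ 2 - 2 * a ^ 2) / (1 + a ^ 2 + b ^ 2) ^ 2),
          ρ * (-(4 * a * b) / (1 + a ^ 2 + b ^ 2) ^ 2), 2 * a / (1 + a ^ 2 + b ^ 2);
         ρ * (-(4 * a * b) / (1 + a ^ 2 + b ^ 2) ^ 2),
          ρ * ((2 + 2 * a ^ 2 - 2 * b ^ 2) / (1 + a ^ 2 + b ^ 2) ^ 2), 2 * b / (1 + a ^ 2 + b ^ 2);
         ρ * (-(4 * a) / (1 + a ^ 2 + b ^ 2) ^ 2), ρ * (-(4 * b) / (1 + a ^ 2 + b ^ 2) ^ 2),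
          (1 - a ^ 2 - b ^ 2) / (1 + a ^ 2 + b ^ 2)] : Matrix (Fin 3) (Fin 3) ℝ).det =
        4 * ρ ^ 2 / (1 + a ^ 2 + b ^ 2) ^ 2 :=
  fun a b ρ => IsotropySpace.det_stereoBlock (p := fun a b => 2 * a / (1 + a ^ 2 + b ^ 2))
    (q := fun a b => 2 * b / (1 + a ^ 2 + b ^ 2))
    (t := fun a b => (1 - a ^ 2 - b ^ 2) / (1 + a ^ 2 + b ^ 2))
    (pa := fun a b => (2 + 2 * b ^ 2 - 2 * a ^ 2) / (1 + a ^ 2 + b ^ 2) ^ 2)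
    (pb := fun a b => -(4 * a * b) / (1 + a ^ 2 + b ^ 2) ^ 2)
    (qa := fun a b => -(4 * a * b) / (1 + a ^ 2 + b ^ 2) ^ 2)
    (qb := fun a b => (2 + 2 * a ^ 2 - 2 * b ^ 2) / (1 + a ^ 2 + b ^ 2) ^ 2)
    (ta := fun a b => -(4 * a) / (1 + a ^ 2 + b ^ 2) ^ 2)
    (tb := fun a b => -(4 * b) / (1 + a ^ 2 + b ^ 2) ^ 2)
    (fun _ _ => rfl) (fun _ _ => rfl) (fun _ _ => rfl) (fun _ _ => rfl) (fun _ _ => rfl)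
    (fun _ _ => rfl) (fun _ _ => rfl) (fun _ _ => rfl) (fun _ _ => rfl) a b ρ

end Summit.KontsevichZagierPeriods.InverseLandau

end
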